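import Summits.NavierStokesRegularity.FluidComputer.GateBudgetClockBand
import HarnessLib

/-!
# GateBudget part 99 — the swing clock: the clock angle in lockstep with the dose phase (§274–§275)

Cell `pub-fluidc`, blueprint seat bp1 (gen 38, third item); namespace
`Summit.NavierStokesRegularity.FluidComputer.GateBudget`, knob family
`RotorKnob.rotorCircuit K M ε ρ` (modes `0 = a` carrier, `1 = b` clock, `2 = c` trigger,
`3 = d` transfer, `4 = ã` output) from `delayInit`, with a trigger primitive `C` (`C' = c`, a
hypothesis as in parts 49–71). Imports part 73 (`GateBudgetClockBand`, §222's band law).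
HONEST FRAMING: a low prior, high value-of-information experiment on Tao's machine paradigm;
NOT a claim that NS blows up. Nothing here is about the Navier–Stokes equations.

THE POINT (SPEC-INPUT-bp1 §BU(3)(b)). After part 98 the clean dud horizon (sufficiency,
`N - 1 ≤ 0.034K⁹`) and part 72's necessity ceiling (`0.1415K⁹ + 1`) differ by ONE constant:
the output transferred by one pulse, ceiling `U = 7/2 + k²/3` per rung (part 75 §226, of which
`3.33 = 4.16/θ` is the SWING `t₂ - t₁ ≤ 4.16/(θK¹⁰)` of part 73 §223 priced at the crude rate
`ã' = Kd² ≤ K`) against the floor `1` (part 71 §217). Both laws read the output in the DOSE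
PHASE `Φ = (C - C(r))/ρ²` (`ã' = Kd²`, `d ≈` the turned carrier `S(Φ) = sin Φ·a(r) +
cos Φ·d(r)`, part 14 §43), i.e. `dã = Kρ²·S(Φ)²/c·dΦ`, and both price `1/c` by a CONSTANT. The
truth on the swing band: the clock runs on its ring `b = R cos α`, `c = R sin α` (`α` the CLOCK
ANGLE) and Tao's pump `b' = εa² - μc²` (`μ = ε⁻¹M`) turns it at `α' = μc` exactly when
`εa² = μ(Q - R²)` is absorbed into the ring slack — while the dose phase turns at `Φ' = c/ρ²`.
So `dα = μρ²·dΦ = dΦ/k` on the lattice `ε = kK¹⁰ρ²`: THE CLOCK ANGLE AND THE DOSE PHASE ADVANCE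
IN LOCKSTEP, and `1/c = 1/(R sin α)` is a known function of the phase along the band. Then
(heuristic, part 71's docstring) `Δã_swing ≈ (A/(θK⁹))∫ sin²(kα + ψ)/sin α dα ≈ 1.95A/(θK⁹)` at
`k = 1` instead of `4.16/(θK⁹)`: the swing is over-priced by a factor `≈ 2.1`, the whole rung by
`≈ 2.1` (`U ≈ 1.8` instead of `3.83` at `k = 1`), and the clean dud horizon would sit within a
factor `≈ 2` of the necessity ceiling. THIS FILE proves the lockstep (clock side only) and the
calculus of the resulting transfer integral; the output comparison is part 100.

* §274 `clock_angle_lower` (any member, `ε, M > 0`): on `[s, t]` with a ring from below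
  `R₂² + ε²/M ≤ Q ≤ b² + c²`, inside the band `b² < R₂²`, and with `κc ≤ √(R₂² - b²)`
  (`κ` = the ring's aspect defect, `= 0.9999` on a headline pulse by §275 `band_kappa_headline`):
  `ε⁻¹Mκ·(C(t) - C(s)) ≤ arccos(b(t)/R₂) - arccos(b(s)/R₂)` — the clock angle advances AT
  LEAST `κ/k` per radian of dose phase (`α' = -b'/√(R₂² - b²) ≥ μ√(R₂² - b²) ≥ μκc` from
  §222's logistic inequality `b' ≤ -μ(R₂² - b²)`).
* §274 `clock_angle_upper` (any member, `ε > 0`, `M ≥ 0`): on `[s, t]` with a ring from above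
  `b² + c² ≤ R₁²` and `c > 0`: `arccos(b(t)/R₁) - arccos(b(s)/R₁) ≤ ε⁻¹M·(C(t) - C(s))` — AT MOST
  `1/k` per radian (`-b' = μc² - εa² ≤ μc²`, `√(R₁² - b²) ≥ c`).
* §275 `trigger_ge_sin_angle`: `R₂² ≤ b² + c²`, `b² ≤ R₂²`, `c ≥ 0` ⇒ `R₂·sin(arccos(b/R₂)) ≤ c`;
  `band_kappa_pointwise`, `band_kappa_headline`: on the band `b² ≤ (31/32)²θ²ε²` of a headline
  pulse (ring `(1 - 2·10⁻⁶)θ²ε² ≤ R₂²`, `b² + c² ≤ θ²ε² + 2ε²/10⁶`, `θ ≥ 5/4`) the defect is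
  `κ = 9999/10000`.
* §275 `swingPrim`, `hasDerivAt_swingPrim`: THE SWING PRIMITIVE
  `P(w) = -cos²ψ·cos w + sin 2ψ·sin w + (sin²ψ + E)·log tan(w/2) + sin²ψ·cos w` has
  `P'(w) = (sin²(w + ψ) + E)/sin w` on `(0, π)` — the transfer integrand of the swing at `k = 1`
  (`S(Φ)² = A sin²(α + ψ)`, `E` the phase-tracking drift); `swingPrim_eval_le`: on a half band
  `0 < α₁ ≤ w ≤ π/2`, `E ≥ 0`:
  `P(w) - P(α₁) ≤ cos²ψ·cos α₁ + |sin 2ψ|·(1 - sin α₁) - (sin²ψ + E)·log tan(α₁/2)`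
  (`= 0.969cos²ψ + 0.752|sin 2ψ| + 2.073(sin²ψ + E)` at the band edge `cos α₁ = 31/32`, and
  `0.9375cos²ψ + 0.652|sin 2ψ| + 1.717(sin²ψ + E)` at the fall edge `cos α₁ = 15/16`).

HONEST LIMITS. (i) Clock and calculus only: no statement about the output `ã` is made here —
the comparison `ã - (Kρ²/(λR₂))·P(α₁ + λ(Φ - Φ₁))` non-increasing on a half band, the choice of
the split time, the phase offsets `ψ` at the band edges (`|ψ| ≲ 10⁻²` needs the climb's dose
`0.247k ≤ Φ(t₁) ≤ 0.258k`) and the re-assembly of parts 75/76/90/97/98 with the smaller `U`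
are NOT done (SPEC-INPUT-bp1 §BV lists them); until then `U = 7/2 + k²/3` stands and the numbers
`1.95`, `1.8`, `≈ 2` above are a FORECAST; (ii) the primitive is the `k = 1` integrand; for
`k ≥ 2` the integrand `sin²(kw + ψ)/sin w` is a trigonometric polynomial times `1/sin w` and is
not treated; (iii) `κ`, `31/32`, `2·10⁻⁶` are bookkeeping constants matched to part 73 §223 and
part 61 §188, not optimised; (iv) nothing about Navier–Stokes.
[cite: Tao2016AveragedNS, §5.5 Theorem 5.3, (5.5), (b-eq), (c-eq), (energy-con), (tcable)]
-/

noncomputable section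

namespace Summit.NavierStokesRegularity.FluidComputer.GateBudget

open Real Set Filter Topology
open Literature.Analysis.FluidPDE.Tao2016AveragedNS

variable {K M ε ρ : ℝ} {X : ℝ → Fin 5 → ℝ} {C : ℝ → ℝ}

/-! ## §274 The clock angle against the dose phase -/

/-- `√(1 - (b/R)²) = √(R² - b²)/R` for `R > 0`. [folklore] -/
theorem clock_ring_sqrt {b R : ℝ} (hR : 0 < R) :
    √(1 - (b / R) ^ 2) = √(R ^ 2 - b ^ 2) / R := by
  have e : 1 - (b / R) ^ 2 = (R ^ 2 - b ^ 2) / R ^ 2 := by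
    field_simp
  rw [e, Real.sqrt_div' _ (by positivity), Real.sqrt_sq hR.le]

/-- The clock angle `arccos(b/R)` is differentiable inside the band `b² < R²`, with derivative
`-b'/√(R² - b²)`. [derived: Mathlib `Real.hasDerivAt_arccos`] -/
theorem hasDerivAt_clock_angle (hX : ∀ t, HasDerivAt X (RotorKnob.rotorCircuit K M ε ρ (X t)) t)
    {R : ℝ} (hR : 0 < R) {u : ℝ} (hb : X u 1 ^ 2 < R ^ 2) :
    HasDerivAt (fun s => arccos (X s 1 / R))
      (-(ε * X u 0 ^ 2 - ε⁻¹ * M * X u 2 ^ 2) / √(R ^ 2 - X u 1 ^ 2)) u := by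
  obtain ⟨h1, h2⟩ := abs_lt_of_sq_lt_sq' hb hR.le
  have hx1 : X u 1 / R ≠ -1 := by
    intro h
    have : X u 1 = -R := by field_simp at h; linarith only [h]
    linarith only [this, h1]
  have hx2 : X u 1 / R ≠ 1 := by
    intro h
    have : X u 1 = R := by field_simp at h; linarith only [h]
    linarith only [this, h2]
  have hD : 0 < √(R ^ 2 - X u 1 ^ 2) := Real.sqrt_pos.2 (by linarith only [hb])
  have h := (Real.hasDerivAt_arccos hx1 hx2).comp u ((RotorKnob.hasDerivAt_b hX u).div_const R)
  refine h.congr_deriv ?_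
  rw [clock_ring_sqrt hR]
  field_simp

/-- §274 THE LOWER ANGLE LAW (any member from `delayInit`, `ε, M > 0`, any trigger primitive
`C`). On `[s, t]` let `R₂ > 0`, `R₂² + ε²/M ≤ Q ≤ b² + c²` (ring from below), `b² < R₂²` (the
band) and `κc ≤ √(R₂² - b²)` (aspect defect `κ`). Then
`ε⁻¹Mκ·(C(t) - C(s)) ≤ arccos(b(t)/R₂) - arccos(b(s)/R₂)`: per radian of dose phase
`(C(t) - C(s))/ρ²` the clock angle advances at least `ε⁻¹Mρ²κ = κ/k` (lattice `ε = kMρ²`).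
Mechanism: §222's `b' ≤ -μ(R₂² - b²)` gives `(arccos(b/R₂))' = -b'/√(R₂² - b²) ≥ μ√(R₂² - b²)
≥ μκc = μκC'`. [derived: part 73 §222; this file] -/
theorem clock_angle_lower (hX : ∀ t, HasDerivAt X (RotorKnob.rotorCircuit K M ε ρ (X t)) t)
    (h0 : X 0 = delayInit) (hC : ∀ t, HasDerivAt C (X t 2) t) (hε : 0 < ε) (hM : 0 < M)
    {s t R₂ Q κ : ℝ} (hst : s ≤ t) (hR : 0 < R₂) (hQ : R₂ ^ 2 + ε ^ 2 / M ≤ Q)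
    (hring : ∀ u ∈ Icc s t, Q ≤ X u 1 ^ 2 + X u 2 ^ 2)
    (hband : ∀ u ∈ Icc s t, X u 1 ^ 2 < R₂ ^ 2)
    (hκ : ∀ u ∈ Icc s t, κ * X u 2 ≤ √(R₂ ^ 2 - X u 1 ^ 2)) :
    ε⁻¹ * M * κ * (C t - C s) ≤ arccos (X t 1 / R₂) - arccos (X s 1 / R₂) := by
  have hμ : 0 < ε⁻¹ * M := by positivity
  have hmono := Thm53.monotoneOn_sub_of_le_deriv (f := fun u => arccos (X u 1 / R₂))
    (f' := fun u => -(ε * X u 0 ^ 2 - ε⁻¹ * M * X u 2 ^ 2) / √(R₂ ^ 2 - X u 1 ^ 2))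
    (Φ := fun u => ε⁻¹ * M * κ * C u) (φ := fun u => ε⁻¹ * M * κ * X u 2) (convex_Icc s t)
    (fun u hu => hasDerivAt_clock_angle hX hR (hband u hu))
    (fun u _ => (hC u).const_mul (ε⁻¹ * M * κ))
    (fun u hu => by
      have hb := hband u hu
      obtain ⟨D, hD⟩ : ∃ D : ℝ, D = √(R₂ ^ 2 - X u 1 ^ 2) := ⟨_, rfl⟩
      have hDpos : 0 < D := by rw [hD]; exact Real.sqrt_pos.2 (by linarith only [hb])
      have hD2 : D ^ 2 = R₂ ^ 2 - X u 1 ^ 2 := by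
        rw [hD, Real.sq_sqrt (by linarith only [hb])]
      -- the logistic inequality `-b' ≥ μ(R₂² - b²) = μD²`
      have key : ε⁻¹ * M * D ^ 2 ≤ -(ε * X u 0 ^ 2 - ε⁻¹ * M * X u 2 ^ 2) := by
        have ha := RotorKnob.traj_sq_le_one hX h0 u 0
        have hc2 : R₂ ^ 2 + ε ^ 2 / M - X u 1 ^ 2 ≤ X u 2 ^ 2 := by
          linarith only [hring u hu, hQ]
        have e1 : ε⁻¹ * M * (ε ^ 2 / M) = ε := by
          field_simp
        have h3 := mul_le_mul_of_nonneg_left hc2 hμ.le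
        have h4 : ε * X u 0 ^ 2 ≤ ε * 1 := mul_le_mul_of_nonneg_left ha hε.le
        rw [hD2]
        nlinarith only [h3, h4, e1]
      -- `μκc·D ≤ μD·D`
      have h5 : κ * X u 2 * D ≤ D * D := by
        have := hκ u hu
        rw [← hD] at this
        exact mul_le_mul_of_nonneg_right this hDpos.le
      show ε⁻¹ * M * κ * X u 2 ≤ -(ε * X u 0 ^ 2 - ε⁻¹ * M * X u 2 ^ 2) / √(R₂ ^ 2 - X u 1 ^ 2)
      rw [← hD, le_div_iff₀ hDpos]
      nlinarith only [key, h5, hμ])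
  have h := hmono (left_mem_Icc.2 hst) (right_mem_Icc.2 hst) hst
  dsimp only at h
  have e : ε⁻¹ * M * κ * (C t - C s) = ε⁻¹ * M * κ * C t - ε⁻¹ * M * κ * C s := by ring
  linarith only [h, e]

/-- §274 THE UPPER ANGLE LAW (any member from `delayInit`, `ε > 0`, `M ≥ 0`). On `[s, t]` let
`R₁ > 0`, `b² + c² ≤ R₁²` (ring from above) and `c > 0`. Then
`arccos(b(t)/R₁) - arccos(b(s)/R₁) ≤ ε⁻¹M·(C(t) - C(s))`: at most `1/k` per radian of dose
phase (`-b' = μc² - εa² ≤ μc²` and `√(R₁² - b²) ≥ c`, so `(arccos(b/R₁))' ≤ μc = μC'`).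
[derived: this file] -/
theorem clock_angle_upper (hX : ∀ t, HasDerivAt X (RotorKnob.rotorCircuit K M ε ρ (X t)) t)
    (hC : ∀ t, HasDerivAt C (X t 2) t) (hε : 0 < ε) (hM : 0 ≤ M) {s t R₁ : ℝ} (hst : s ≤ t)
    (hR : 0 < R₁) (hring : ∀ u ∈ Icc s t, X u 1 ^ 2 + X u 2 ^ 2 ≤ R₁ ^ 2)
    (hpos : ∀ u ∈ Icc s t, 0 < X u 2) :
    arccos (X t 1 / R₁) - arccos (X s 1 / R₁) ≤ ε⁻¹ * M * (C t - C s) := by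
  have hμ : 0 ≤ ε⁻¹ * M := by positivity
  have hband : ∀ u ∈ Icc s t, X u 1 ^ 2 < R₁ ^ 2 := fun u hu => by
    nlinarith only [hring u hu, hpos u hu]
  have hanti := Thm53.antitoneOn_sub_of_deriv_le (f := fun u => arccos (X u 1 / R₁))
    (f' := fun u => -(ε * X u 0 ^ 2 - ε⁻¹ * M * X u 2 ^ 2) / √(R₁ ^ 2 - X u 1 ^ 2))
    (Φ := fun u => ε⁻¹ * M * C u) (φ := fun u => ε⁻¹ * M * X u 2) (convex_Icc s t)
    (fun u hu => hasDerivAt_clock_angle hX hR (hband u hu))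
    (fun u _ => (hC u).const_mul (ε⁻¹ * M))
    (fun u hu => by
      have hb := hband u hu
      have hc := hpos u hu
      obtain ⟨D, hD⟩ : ∃ D : ℝ, D = √(R₁ ^ 2 - X u 1 ^ 2) := ⟨_, rfl⟩
      have hDpos : 0 < D := by rw [hD]; exact Real.sqrt_pos.2 (by linarith only [hb])
      have hD2 : D ^ 2 = R₁ ^ 2 - X u 1 ^ 2 := by
        rw [hD, Real.sq_sqrt (by linarith only [hb])]
      -- `c ≤ D`
      have hcD : X u 2 ≤ D := by
        rw [hD]
        exact le_trans (le_abs_self _) (Real.abs_le_sqrt (by linarith only [hring u hu]))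
      have hεa : 0 ≤ ε * X u 0 ^ 2 := by positivity
      -- `-b'·1 ≤ μc² ≤ μc·D`
      have h5 : ε⁻¹ * M * X u 2 ^ 2 ≤ ε⁻¹ * M * X u 2 * D := by
        have := mul_le_mul_of_nonneg_left hcD (mul_nonneg hμ hc.le)
        nlinarith only [this]
      show -(ε * X u 0 ^ 2 - ε⁻¹ * M * X u 2 ^ 2) / √(R₁ ^ 2 - X u 1 ^ 2) ≤ ε⁻¹ * M * X u 2
      rw [← hD, div_le_iff₀ hDpos]
      linarith only [hεa, h5])
  have h := hanti (left_mem_Icc.2 hst) (right_mem_Icc.2 hst) hst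
  dsimp only at h
  have e : ε⁻¹ * M * (C t - C s) = ε⁻¹ * M * C t - ε⁻¹ * M * C s := by ring
  linarith only [h, e]

/-! ## §275 The trigger on the ring, the aspect defect of the band, and the swing primitive -/

/-- §275 THE TRIGGER IS THE SINE OF THE CLOCK ANGLE (pure algebra, `R₂ > 0`): `R₂² ≤ b² + c²`,
`b² ≤ R₂²`, `c ≥ 0` ⇒ `R₂·sin(arccos(b/R₂)) = √(R₂² - b²) ≤ c`. [folklore] -/
theorem trigger_ge_sin_angle {b c R₂ : ℝ} (hR : 0 < R₂) (hring : R₂ ^ 2 ≤ b ^ 2 + c ^ 2)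
    (hc : 0 ≤ c) : R₂ * sin (arccos (b / R₂)) ≤ c := by
  rw [Real.sin_arccos, clock_ring_sqrt hR, mul_div_cancel₀ _ hR.ne']
  calc √(R₂ ^ 2 - b ^ 2) ≤ √(c ^ 2) := Real.sqrt_le_sqrt (by linarith only [hring])
    _ = c := Real.sqrt_sq hc

/-- §275 THE ASPECT DEFECT, pointwise (pure algebra): `c² ≤ Q₁ - b²` and
`κ²(Q₁ - b²) ≤ R₂² - b²` ⇒ `κc ≤ √(R₂² - b²)`. [folklore] -/
theorem band_kappa_pointwise {b c R₂ Q₁ κ : ℝ} (hcq : c ^ 2 ≤ Q₁ - b ^ 2)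
    (hk : κ ^ 2 * (Q₁ - b ^ 2) ≤ R₂ ^ 2 - b ^ 2) : κ * c ≤ √(R₂ ^ 2 - b ^ 2) := by
  refine le_trans (le_abs_self _) (Real.abs_le_sqrt ?_)
  have := mul_le_mul_of_nonneg_left hcq (sq_nonneg κ)
  nlinarith only [this, hk]

/-- §275 THE ASPECT DEFECT OF A HEADLINE BAND: on the band `b² ≤ (31/32)²θ²ε²` of a pulse whose
clock ring is kept to `(1 - 2·10⁻⁶)θ²ε² ≤ R₂²` below and `b² + c² ≤ θ²ε² + 2ε²/10⁶` above
(part 61 §188 / part 73 §223, `θ ≥ 5/4`), `0.9999·c ≤ √(R₂² - b²)`. [derived: this file] -/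
theorem band_kappa_headline {θ b c R₂ : ℝ} (hθ : 5 / 4 ≤ θ) (hε : 0 < ε)
    (hR : (1 - 2 / 10 ^ 6) * (θ * ε) ^ 2 ≤ R₂ ^ 2) (hb : b ^ 2 ≤ (31 / 32) ^ 2 * (θ * ε) ^ 2)
    (hring : b ^ 2 + c ^ 2 ≤ (θ * ε) ^ 2 + 2 * ε ^ 2 / 10 ^ 6) :
    9999 / 10000 * c ≤ √(R₂ ^ 2 - b ^ 2) := by
  refine band_kappa_pointwise (Q₁ := (θ * ε) ^ 2 + 2 * ε ^ 2 / 10 ^ 6)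
    (by linarith only [hring]) ?_
  have hθε : 25 / 16 * ε ^ 2 ≤ (θ * ε) ^ 2 := by
    nlinarith only [mul_le_mul_of_nonneg_right hθ hε.le, hε, hθ]
  nlinarith only [hR, hb, hθε, sq_nonneg ε]

/-- §275 THE SWING PRIMITIVE `P_{ψ,E}(w) = -cos²ψ·cos w + sin 2ψ·sin w + (sin²ψ + E)·log tan(w/2)
+ sin²ψ·cos w` (with `log tan(w/2)` spelled `log sin(w/2) - log cos(w/2)`): an antiderivative on
`(0, π)` of the `k = 1` transfer integrand `(sin²(w + ψ) + E)/sin w` (turned carrier over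
trigger, in the clock angle `w`, phase offset `ψ`, drift `E`). [derived: this file] -/
def swingPrim (ψ E w : ℝ) : ℝ :=
  -(cos ψ ^ 2) * cos w + sin (2 * ψ) * sin w
    + (sin ψ ^ 2 + E) * (log (sin (w / 2)) - log (cos (w / 2))) + sin ψ ^ 2 * cos w

/-- §275 `P' = (sin²(w + ψ) + E)/sin w` on `0 < w < π` (`(log tan(w/2))' = 1/sin w`).
[derived: this file] -/
theorem hasDerivAt_swingPrim (ψ E : ℝ) {w : ℝ} (hw0 : 0 < w) (hwπ : w < π) :
    HasDerivAt (swingPrim ψ E) ((sin (w + ψ) ^ 2 + E) / sin w) w := by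
  have hS : 0 < sin (w / 2) := Real.sin_pos_of_pos_of_lt_pi (by linarith) (by linarith)
  have hCo : 0 < cos (w / 2) :=
    Real.cos_pos_of_mem_Ioo ⟨by linarith [Real.pi_pos], by linarith⟩
  have hsw : 0 < sin w := Real.sin_pos_of_pos_of_lt_pi hw0 hwπ
  have hsin2 : sin w = 2 * sin (w / 2) * cos (w / 2) := by
    rw [← Real.sin_two_mul]; ring_nf
  have hid : HasDerivAt (fun x : ℝ => x / 2) (1 / 2) w := (hasDerivAt_id' w).div_const 2
  -- the four pieces
  have h1 : HasDerivAt (fun x => -(cos ψ ^ 2) * cos x) (-(cos ψ ^ 2) * -sin w) w :=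
    (Real.hasDerivAt_cos w).const_mul _
  have h2 : HasDerivAt (fun x => sin (2 * ψ) * sin x) (sin (2 * ψ) * cos w) w :=
    (Real.hasDerivAt_sin w).const_mul _
  have h3 : HasDerivAt (fun x => (sin ψ ^ 2 + E) * (log (sin (x / 2)) - log (cos (x / 2))))
      ((sin ψ ^ 2 + E) * (cos (w / 2) * (1 / 2) / sin (w / 2)
        - -sin (w / 2) * (1 / 2) / cos (w / 2))) w :=
    ((hid.sin.log hS.ne').sub (hid.cos.log hCo.ne')).const_mul _
  have h4 : HasDerivAt (fun x => sin ψ ^ 2 * cos x) (sin ψ ^ 2 * -sin w) w :=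
    (Real.hasDerivAt_cos w).const_mul _
  have h := ((h1.add h2).add h3).add h4
  refine h.congr_deriv ?_
  -- `(log tan(w/2))' = 1/sin w`
  have e3 : cos (w / 2) * (1 / 2) / sin (w / 2) - -sin (w / 2) * (1 / 2) / cos (w / 2)
      = 1 / sin w := by
    have eL : cos (w / 2) * (1 / 2) / sin (w / 2) - -sin (w / 2) * (1 / 2) / cos (w / 2)
        = (sin (w / 2) ^ 2 + cos (w / 2) ^ 2) / (2 * sin (w / 2) * cos (w / 2)) := by
      field_simp
      ring
    rw [eL, Real.sin_sq_add_cos_sq, hsin2]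
  have h1s : 1 / sin w * sin w = 1 := by
    field_simp
  rw [e3, eq_div_iff hsw.ne', Real.sin_add, Real.sin_two_mul]
  linear_combination (sin ψ ^ 2 + E) * h1s - sin ψ ^ 2 * Real.sin_sq_add_cos_sq w

/-- §275 THE HALF-BAND VALUE of the swing primitive: for `0 < α₁ ≤ w ≤ π/2` and `E ≥ 0`,
`P(w) - P(α₁) ≤ cos²ψ·cos α₁ + |sin 2ψ|·(1 - sin α₁) - (sin²ψ + E)·log tan(α₁/2)`
(`cos` falls, `sin` rises and `log tan(w/2) ≤ 0` on the half band). At part 73's band edge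
`cos α₁ = 31/32` this is `0.969cos²ψ + 0.752|sin 2ψ| + 2.073(sin²ψ + E)`; at the fall edge
`cos α₁ = 15/16` it is `0.9375cos²ψ + 0.652|sin 2ψ| + 1.717(sin²ψ + E)`. [derived: this file] -/
theorem swingPrim_eval_le (ψ : ℝ) {E α₁ w : ℝ} (hE : 0 ≤ E) (hα : 0 < α₁) (hαw : α₁ ≤ w)
    (hw : w ≤ π / 2) :
    swingPrim ψ E w - swingPrim ψ E α₁
      ≤ cos ψ ^ 2 * cos α₁ + |sin (2 * ψ)| * (1 - sin α₁)
        - (sin ψ ^ 2 + E) * (log (sin (α₁ / 2)) - log (cos (α₁ / 2))) := by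
  have hπ := Real.pi_pos
  have hcosw : 0 ≤ cos w := Real.cos_nonneg_of_mem_Icc ⟨by linarith, hw⟩
  have hcos : cos w ≤ cos α₁ :=
    Real.cos_le_cos_of_nonneg_of_le_pi hα.le (by linarith) hαw
  have hsin : sin α₁ ≤ sin w :=
    Real.sin_le_sin_of_le_of_le_pi_div_two (by linarith) hw hαw
  have hsin1 : sin w ≤ 1 := Real.sin_le_one w
  -- the half-angle sines and cosines
  have hSα : 0 < sin (α₁ / 2) := Real.sin_pos_of_pos_of_lt_pi (by linarith) (by linarith)
  have hSw : 0 < sin (w / 2) := Real.sin_pos_of_pos_of_lt_pi (by linarith) (by linarith)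
  have hCw : 0 < cos (w / 2) := Real.cos_pos_of_mem_Ioo ⟨by linarith, by linarith⟩
  have hSmono : sin (α₁ / 2) ≤ sin (w / 2) :=
    Real.sin_le_sin_of_le_of_le_pi_div_two (by linarith) (by linarith) (by linarith)
  have hCmono : cos (w / 2) ≤ cos (α₁ / 2) :=
    Real.cos_le_cos_of_nonneg_of_le_pi (by linarith) (by linarith) (by linarith)
  have hSC : sin (w / 2) ≤ cos (w / 2) := by
    rw [← Real.sin_pi_div_two_sub]
    exact Real.sin_le_sin_of_le_of_le_pi_div_two (by linarith) (by linarith) (by linarith)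
  -- `log tan(w/2) ≤ 0` and `log tan` rises
  have hlogw : log (sin (w / 2)) - log (cos (w / 2)) ≤ 0 := by
    linarith only [Real.log_le_log hSw hSC]
  have hlogmono : log (sin (α₁ / 2)) - log (cos (α₁ / 2))
      ≤ log (sin (w / 2)) - log (cos (w / 2)) := by
    linarith only [Real.log_le_log hSα hSmono, Real.log_le_log hCw hCmono]
  have hc2 : 0 ≤ cos ψ ^ 2 := sq_nonneg _
  have hs2 : 0 ≤ sin ψ ^ 2 := sq_nonneg _
  -- the cross term `sin 2ψ·(sin w - sin α₁) ≤ |sin 2ψ|·(1 - sin α₁)`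
  have hcross : sin (2 * ψ) * (sin w - sin α₁) ≤ |sin (2 * ψ)| * (1 - sin α₁) := by
    have h1 : sin (2 * ψ) * (sin w - sin α₁) ≤ |sin (2 * ψ)| * (sin w - sin α₁) :=
      mul_le_mul_of_nonneg_right (le_abs_self _) (by linarith only [hsin])
    have h2 : |sin (2 * ψ)| * (sin w - sin α₁) ≤ |sin (2 * ψ)| * (1 - sin α₁) :=
      mul_le_mul_of_nonneg_left (by linarith only [hsin1]) (abs_nonneg _)
    linarith only [h1, h2]
  have hlog1 : (sin ψ ^ 2 + E) * (log (sin (w / 2)) - log (cos (w / 2))) ≤ 0 :=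
    mul_nonpos_of_nonneg_of_nonpos (by positivity) hlogw
  have hm1 := mul_le_mul_of_nonneg_left hcos hs2
  have hm2 := mul_le_mul_of_nonneg_left hcosw hc2
  unfold swingPrim
  nlinarith only [hcross, hlog1, hm1, hm2, hc2, hcos]

end Summit.NavierStokesRegularity.FluidComputer.GateBudget
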